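import Summits.ResolutionOfSingularities.ResolutionOfSingularities.Theses.HilbertSamuelElimination
import Literature.AlgebraicGeometry.Resolution.HilbertSamuelStrata
import Mathlib.AlgebraicGeometry.Morphisms.Proper
import HarnessLib

/-!
# Route `HilbertSamuelElimination`, crux `SigmaMaxModificationsCorridor3`
# (stmt-ResolutionOfSingularities-19249; child of `SigmaMaxModifications` stmt-…-18506),
# lines `tame_wild` / `corridor3_levels` — definitions

[OURS · L1 W4.2] The local vocabulary of the registered line skeletons
`Cruxes/SigmaMaxModificationsCorridor3/Lines/tame_wild.lean` (active skeleton of item 19249) and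
`…/corridor3_levels.lean` as NAMED definitions importable from `Theorems/`, so that the registered
stubs of those lines (`stub_levelRaiseDim`, `stub_isolatedNu3`, `stub_tameNu3`, `stub_wildNu3`,
whose signatures mention `HSBody`, `NuMod`, `IsTameValue`) can be landed BY NAME AND SIGNATURE in
`Theorems/` files. Every body below is copied VERBATIM from `Lines/tame_wild.lean` (the bodies of
`HSBody` in `corridor3_levels.lean` and in the parent's `Lines/hs_curve_locus.lean` are the same
text). NOT statements of any manuscript; no theorem of this file concludes a crux.

* `HSBody X N` — `B(X, N)`, the seven-clause body of the cruxes `SigmaMaxModifications` /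
  `SigmaMaxModificationsCorridor3` at level `N` (CJS Def. 6.15 in modification form) over the
  tree vocabulary `Scheme.hsFun / hsMaxLocus / hsValues`; the route decls' inline `H^N`, `X_max`,
  `Σ_X` are these by `rfl` (`sigmaMaxModificationsCorridor3_iff` below is re-abstraction of one
  and the same term).
* `NuMod Y N d ν` — a `ν`-modification of `Y` at level `N` inside the class `{dim ≤ d}` (CJS
  Def. 6.14 in modification form; the hypothesis shape of the landed graded glue
  `stub_gradedGlue`).
* `hypersurfaceHF m` — the Hilbert function `n ↦ C(n+3,3) - C(n+3-m,3)` of a hypersurface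
  singularity of multiplicity `m` in embedding dimension `4`.
* `IsTameValue p ν` — `ν = hypersurfaceHF m` for some `m < p`.

## Sources

* V. Cossart, U. Jannsen, S. Saito, LNM 2270 (2020): Def. 2.28, Thm. 2.3, Lemma 2.23,
  Def. 6.14/6.15, Rem. 6.24. [CossartJannsenSaito2020]
-/

set_option linter.dupNamespace false -- mandated namespace of this single-conjunct summit

noncomputable section

open CategoryTheory AlgebraicGeometry TopologicalSpace Topology
open Literature.AlgebraicGeometry.Resolution Literature.RingTheory.HilbertSamuel
open Summit.ResolutionOfSingularities.ResolutionOfSingularities.Theses.HilbertSamuelElimination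

namespace Summit.ResolutionOfSingularities.ResolutionOfSingularities.Theorems.SigmaMaxModificationsCorridor3.TameWild

/-! ## Bodies -/

/-- `B(X, N)`: the seven-clause body of the crux at level `N` (CJS Def. 6.15 in modification
form; the route decl's inline `H^N` / `X_max` / `Σ_X` are `Scheme.hsFun / hsMaxLocus / hsValues`
by `rfl`): a proper `π : X' ⟶ X`, `X'` reduced, `dim X' ≤ N`, an isomorphism over every open inside
`X ∖ X_max(N)`, dense preimage of `X ∖ X_max(N)`, `H^N` non-increasing, and no maximal value of
`Σ_X(N)` a value of `Σ_{X'}(N)`. Verbatim the lines' `HSBody`.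
[cite: CossartJannsenSaito2020, Def. 6.15] -/
def HSBody (X : Scheme.{0}) (N : ℕ) : Prop :=
  ∃ (X' : Scheme.{0}) (π : X' ⟶ X), IsProper π ∧ IsReduced X' ∧
    topologicalKrullDim X' ≤ (N : WithBot ℕ∞) ∧
    (∀ U : X.Opens, (U : Set X) ⊆ (Scheme.hsMaxLocus X N)ᶜ → IsIso (π ∣_ U)) ∧
    Dense ((fun x' => π.base x') ⁻¹' (Scheme.hsMaxLocus X N)ᶜ) ∧
    (∀ x' : X', Scheme.hsFun X' N x' ≤ Scheme.hsFun X N (π.base x')) ∧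
    ∀ ν : ℕ → ℕ, Maximal (· ∈ Scheme.hsValues X N) ν → ν ∉ Scheme.hsValues X' N

/-- **`ν`-modification of `Y` at level `N` inside the class `{dim ≤ d}`** (CJS Def. 6.14 in
modification form = the hypothesis shape of the landed graded glue `stub_gradedGlue`): a proper
`π : Y' ⟶ Y`, `Y'` reduced with `dim Y' ≤ d`, `dim Y' ≤ N`, an isomorphism over every open inside
`Y ∖ Y(ν)`, dense such opens pulled back to dense opens, `H^N` non-increasing, and `ν` no longer a
value of `Σ_{Y'}(N)`. Verbatim the line's `NuMod`.
[cite: CossartJannsenSaito2020, Def. 6.14, Rem. 6.24] -/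
def NuMod (Y : Scheme.{0}) (N d : ℕ) (ν : ℕ → ℕ) : Prop :=
  ∃ (Y' : Scheme.{0}) (π : Y' ⟶ Y), IsProper π ∧ IsReduced Y' ∧
    topologicalKrullDim Y' ≤ (d : WithBot ℕ∞) ∧ topologicalKrullDim Y' ≤ (N : WithBot ℕ∞) ∧
    (∀ U : Y.Opens, (U : Set Y) ⊆ (Scheme.hsStratum Y N ν)ᶜ → IsIso (π ∣_ U)) ∧
    (∀ U : Y.Opens, Dense (U : Set Y) → (U : Set Y) ⊆ (Scheme.hsStratum Y N ν)ᶜ →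
      Dense ((π ⁻¹ᵁ U : Y'.Opens) : Set Y')) ∧
    (∀ y' : Y', Scheme.hsFun Y' N y' ≤ Scheme.hsFun Y N (π.base y')) ∧
    ν ∉ Scheme.hsValues Y' N

/-! ## The regime: `p`-tame maximal values -/

/-- **The Hilbert function of a hypersurface singularity of multiplicity `m` in embedding
dimension `4`:** `n ↦ C(n+3, 3) - C(n+3-m, 3)` `= Φ^{(4)}(n) - Φ^{(4)}(n - m)` (forms of degree
`n` in four variables modulo the multiples of one form of degree `m`). Verbatim the line's
`hypersurfaceHF`. [cite: CossartJannsenSaito2020, Def. 2.28, Thm. 2.3] -/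
def hypersurfaceHF (m : ℕ) : ℕ → ℕ := fun n => (n + 3).choose 3 - (n + 3 - m).choose 3

/-- **`p`-tame value:** `ν` is the hypersurface Hilbert function of a multiplicity `m < p`.
Verbatim the line's `IsTameValue`. [cite: CossartJannsenSaito2020, Lemma 2.23, Thm. 2.3] -/
def IsTameValue (p : ℕ) (ν : ℕ → ℕ) : Prop := ∃ m : ℕ, m < p ∧ ν = hypersurfaceHF m

/-! ## `rfl` bridges -/

/-- Unfolding `HSBody`. [cite: CossartJannsenSaito2020, Def. 6.15] -/
theorem hsBody_iff (X : Scheme.{0}) (N : ℕ) :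
    HSBody X N ↔
      ∃ (X' : Scheme.{0}) (π : X' ⟶ X), IsProper π ∧ IsReduced X' ∧
        topologicalKrullDim X' ≤ (N : WithBot ℕ∞) ∧
        (∀ U : X.Opens, (U : Set X) ⊆ (Scheme.hsMaxLocus X N)ᶜ → IsIso (π ∣_ U)) ∧
        Dense ((fun x' => π.base x') ⁻¹' (Scheme.hsMaxLocus X N)ᶜ) ∧
        (∀ x' : X', Scheme.hsFun X' N x' ≤ Scheme.hsFun X N (π.base x')) ∧
        ∀ ν : ℕ → ℕ, Maximal (· ∈ Scheme.hsValues X N) ν → ν ∉ Scheme.hsValues X' N :=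
  Iff.rfl

/-- Unfolding `NuMod`. [cite: CossartJannsenSaito2020, Def. 6.14] -/
theorem nuMod_iff (Y : Scheme.{0}) (N d : ℕ) (ν : ℕ → ℕ) :
    NuMod Y N d ν ↔
      ∃ (Y' : Scheme.{0}) (π : Y' ⟶ Y), IsProper π ∧ IsReduced Y' ∧
        topologicalKrullDim Y' ≤ (d : WithBot ℕ∞) ∧ topologicalKrullDim Y' ≤ (N : WithBot ℕ∞) ∧
        (∀ U : Y.Opens, (U : Set Y) ⊆ (Scheme.hsStratum Y N ν)ᶜ → IsIso (π ∣_ U)) ∧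
        (∀ U : Y.Opens, Dense (U : Set Y) → (U : Set Y) ⊆ (Scheme.hsStratum Y N ν)ᶜ →
          Dense ((π ⁻¹ᵁ U : Y'.Opens) : Set Y')) ∧
        (∀ y' : Y', Scheme.hsFun Y' N y' ≤ Scheme.hsFun Y N (π.base y')) ∧
        ν ∉ Scheme.hsValues Y' N :=
  Iff.rfl

/-- Unfolding `IsTameValue`. [cite: CossartJannsenSaito2020, Lemma 2.23] -/
theorem isTameValue_iff (p : ℕ) (ν : ℕ → ℕ) :
    IsTameValue p ν ↔ ∃ m : ℕ, m < p ∧ ν = hypersurfaceHF m :=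
  Iff.rfl

/-- **The crux `SigmaMaxModificationsCorridor3` restated over `HSBody`** — re-abstraction of one
and the same term: the route decl's inline `let H := …` is `Scheme.hsFun` and its
`{x | Maximal (· ∈ Set.range (H X)) (H X x)}` is `Scheme.hsMaxLocus X N`, its `Set.range (H X)` is
`Scheme.hsValues X N`, its `{x | IsRegularLocalRing (X.presheaf.stalk x)}ᶜ` is
`(Scheme.regularLocus X)ᶜ`, all by `rfl` (this is how the line's composition
`SigmaMaxModificationsCorridor3_of` concludes the crux by name).
[cite: CossartJannsenSaito2020, Def. 6.15, Rem. 6.29] -/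
theorem sigmaMaxModificationsCorridor3_iff :
    SigmaMaxModificationsCorridor3 ↔
      ∀ p : ℕ, p.Prime → ∀ (k : Type) [Field k] [CharP k p] (X : Scheme.{0})
        (f : X ⟶ Spec (.of k)), IsSeparated f → LocallyOfFiniteType f → QuasiCompact f →
        IsReduced X → ¬ Scheme.IsRegular X → ((3 : ℕ) : WithBot ℕ∞) ≤ topologicalKrullDim X →
        topologicalKrullDim X ≤ ((3 : ℕ) : WithBot ℕ∞) → ∀ N : ℕ,
        topologicalKrullDim X ≤ (N : WithBot ℕ∞) →
        ¬ Disjoint (closure ((Scheme.regularLocus X)ᶜ \ Scheme.hsMaxLocus X N))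
            (Scheme.hsMaxLocus X N) →
        HSBody X N :=
  Iff.rfl

/-! ## Sanity of the regime predicate (`decide`-level) -/

/-- `hypersurfaceHF 1 = Φ^{(3)}` on an initial segment: multiplicity `1` is the regular value.
[cite: CossartJannsenSaito2020, Def. 2.28] -/
theorem hypersurfaceHF_one_eq_on_range_eight :
    (List.range 8).map (hypersurfaceHF 1) = (List.range 8).map (iterPSum 3 Phi) := by
  decide

/-- The first values of the multiplicity-`2` and `-3` hypersurface functions
(`1, 4, 9, 16, 25` and `1, 4, 10, 19, 31`). [cite: CossartJannsenSaito2020, Thm. 2.3] -/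
theorem hypersurfaceHF_two_three_values :
    (List.range 5).map (hypersurfaceHF 2) = [1, 4, 9, 16, 25] ∧
      (List.range 5).map (hypersurfaceHF 3) = [1, 4, 10, 19, 31] := by
  decide

end Summit.ResolutionOfSingularities.ResolutionOfSingularities.Theorems.SigmaMaxModificationsCorridor3.TameWild

end
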